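import Mathlib
import Summits.Langlands.Langlands.Theorems.IrreducibilityBySelfDualityHeckeEigenvalueFieldStubEndScalarSmooth
import Literature.NumberTheory.Automorphic.ResGLnArchEntryBounds
import Literature.NumberTheory.Automorphic.CuspidalPeterssonForm
import Literature.NumberTheory.Automorphic.HumbertFormsGoodCover
import Literature.NumberTheory.Automorphic.AutomorphicRepsGLCuspFormsRapidDecayMWScaling
import Literature.NumberTheory.Automorphic.UnramifiedHeckeLevel
import HarnessLib

/-!
# From a lifted family on `G_∞ × G(𝔸_f)` to the hypotheses of Borel's lemma on `GL_n(𝔸_K)` —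
crux `HeckeEigenvalueField` (stmt-Langlands-13632), line `Sketch`, stub END-SCALAR, part ADELIC-A

Namespace `Summit.Langlands.Langlands.Theorems.HeckeEigenvalueField.Res`.  Theorems only.  NO
ResConeAnalytic preamble in this file (it needs the product topology of `GL_n(𝔸_K^∞)`); the operator
norm on `M_n(K_∞)` is only opened as a scope, as in DICT-W4/W5/W7 — the smoothness hypothesis `hsm`
below is literally the conclusion of part SMOOTH (`stub_endScalar_contDiffAt_lift`).

* `archPt_mul`, `archPt_ofArch`, `archPt_toAdelic`, `archPt_posRealScalar`, `sndHom_mul_ofArch`,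
  `sndHom_toAdelic`, `archHeight_ofArch_archPt`, `ofArch_archPt_mul_ofFinite` — the archimedean
  component `x_∞ ∈ G_∞` (`GLn.toMixed`) and the finite component `x_f` (`GLn.sndHom`) of adelic points;
* `isOpen_level'`, `continuous_of_coset'`, `stub_endScalar_archGrowth_of_coset_bound` (registered
  sub-stub) — the level is open, so continuity and polynomial bounds in `H_∞` that hold coset by coset
  (constants AND exponents depending on the coset, times a power of the adelic height) are locally
  uniform in `x_f` (finitely many cosets meet a compact; the finite part of the height is bounded on
  compacts);
* `exists_norm_detTwist_le'` — `|χ(det x)| ≤ C (1 ⊔ ‖x‖)^k` for `χ = |·|_𝔸^s`.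
The package itself (`endScalar_adelic_package`) is assembled in part ADELIC-B.

References: A. Borel, H. Jacquet, Corvallis (1979), §1.2, §4.1 and 5.7 [BorelJacquetCorvallis1979];
A. Borel, N. Wallach (2000), VII 2.2 [BorelWallach2000]; G. Harder, Invent. Math. 89 (1987), §3.1
[Harder1987].
-/

set_option linter.dupNamespace false -- project-wide: `Summit.Langlands.Langlands` is the mandated namespace

noncomputable section

open scoped Classical Matrix Matrix.Norms.Operator Topology TensorProduct ContDiff NNReal
open Filter NumberField NumberField.mixedEmbedding IsDedekindDomain Literature.NumberTheory.Automorphic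
open Literature.NumberTheory.Automorphic.RealMatrixGroup
open Literature.NumberTheory.GaloisRepresentations (HeckeCharacter ideleGroup ideleNorm)

namespace Summit.Langlands.Langlands.Theorems.HeckeEigenvalueField.Res

variable {n : ℕ} {K : Type} [Field K] [NumberField K]

/-! ### The archimedean and finite components of adelic points -/

/-- `(a b)_∞ = a_∞ b_∞` in `G_∞`. [folklore] -/
theorem archPt_mul (hcpt : isCompact_glFiniteIntegralLevel n K) (a b : (AdelicGroupData.gl n K).Adelic) :
    (⟨GLn.toMixed n K (a * b), Subgroup.mem_top _⟩ : (AutomorphyDatum.gl n K hcpt).arch.carrier) =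
      (⟨GLn.toMixed n K a, Subgroup.mem_top _⟩ : (AutomorphyDatum.gl n K hcpt).arch.carrier) *
        ⟨GLn.toMixed n K b, Subgroup.mem_top _⟩ :=
  Subtype.ext (map_mul _ _ _)

/-- `(h, 1)_∞ = h`. [folklore] -/
theorem archPt_ofArch (hcpt : isCompact_glFiniteIntegralLevel n K) (h : (AutomorphyDatum.gl n K hcpt).arch.carrier) :
    (⟨GLn.toMixed n K ((AutomorphyDatum.gl n K hcpt).ofArch h), Subgroup.mem_top _⟩ :
      (AutomorphyDatum.gl n K hcpt).arch.carrier) = h :=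
  Subtype.ext (GLn.toMixed_ofInfinite _)

/-- `(a (h, 1))_f = a_f`. [folklore] -/
theorem sndHom_mul_ofArch (hcpt : isCompact_glFiniteIntegralLevel n K) (a : (AdelicGroupData.gl n K).Adelic)
    (h : (AutomorphyDatum.gl n K hcpt).arch.carrier) :
    GLn.sndHom n K (a * (AutomorphyDatum.gl n K hcpt).ofArch h) = GLn.sndHom n K a := by
  rw [GLn.sndHom_mul_adelic, AutomorphyDatum.gl_ofArch_apply, GLn.sndHom_ofInfinite, mul_one]

/-- `γ_∞ = diagArch γ` for `γ ∈ GL_n(K)`. [cite: BorelJacquet1979, §4.1] -/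
theorem archPt_toAdelic (hcpt : isCompact_glFiniteIntegralLevel n K) (γ : GL (Fin n) K) :
    (⟨GLn.toMixed n K ((AdelicGroupData.gl n K).toAdelic γ), Subgroup.mem_top _⟩ :
        (AutomorphyDatum.gl n K hcpt).arch.carrier) =
      (show (AutomorphyDatum.gl n K hcpt).arch.carrier from ParallelWeight.diagArch K n γ) :=
  Subtype.ext (HumbertForm.toMixed_map_algebraMap γ)

/-- `γ_f = globalEmbedding γ` for `γ ∈ GL_n(K)`. [folklore] -/
theorem sndHom_toAdelic (γ : GL (Fin n) K) :
    GLn.sndHom n K ((AdelicGroupData.gl n K).toAdelic γ) = BigHeckeGLn.globalEmbedding n K γ :=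
  HumbertForm.sndHom_map_algebraMap' γ

/-- `z(t)_∞ = exp(log t · 1)` for the split central element `z(t) ∈ A_G`. [folklore] -/
theorem archPt_posRealScalar (hcpt : isCompact_glFiniteIntegralLevel n K) (t : ℝ≥0ˣ) :
    (⟨GLn.toMixed n K (show (AdelicGroupData.gl n K).Adelic from posRealScalar n K t), Subgroup.mem_top _⟩ :
        (AutomorphyDatum.gl n K hcpt).arch.carrier) =
      (AutomorphyDatum.gl n K hcpt).arch.expMem
        ((Real.log ((t : ℝ≥0) : ℝ)) • (⟨1, trivial⟩ : (AutomorphyDatum.gl n K hcpt).arch.lie)) := by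
  have ht : (0 : ℝ) < ((t : ℝ≥0) : ℝ) := NNReal.coe_pos.2 (pos_iff_ne_zero.2 t.ne_zero)
  refine Subtype.ext (Units.ext ?_)
  change ((GLn.toMixed n K (posRealScalar n K t) : GL (Fin n) (mixedSpace K)) : Matrix (Fin n) (Fin n) (mixedSpace K)) = _
  rw [GLn.coe_toMixed_posRealScalar, coe_expMem_smul_one, Real.exp_log ht, Matrix.algebraMap_eq_diagonal]
  rfl

/-- The archimedean height only sees the archimedean component. [folklore] -/
theorem archHeight_ofArch_archPt (hcpt : isCompact_glFiniteIntegralLevel n K) (a : (AdelicGroupData.gl n K).Adelic) :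
    GLn.archHeight n K ((AutomorphyDatum.gl n K hcpt).ofArch ⟨GLn.toMixed n K a, Subgroup.mem_top _⟩) =
      GLn.archHeight n K a := by
  unfold GLn.archHeight
  rw [ResGLnCone.toMixed_ofArch]

/-- `a = (a_∞, 1) · (1, a_f)`. [cite: BorelJacquet1979, §4.1] -/
theorem ofArch_archPt_mul_ofFinite (hcpt : isCompact_glFiniteIntegralLevel n K) (a : (AdelicGroupData.gl n K).Adelic) :
    (AutomorphyDatum.gl n K hcpt).ofArch ⟨GLn.toMixed n K a, Subgroup.mem_top _⟩ *
        (show (AdelicGroupData.gl n K).Adelic from GLn.ofFinite n K (GLn.sndHom n K a)) = a :=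
  GLn.ofInfinite_toMixed_mul_ofFinite_sndHom a

/-- The level `K_f(𝔫)` is open (for `𝔫 = 0` it is the junk level `GL_n(𝒪̂_K)`). [folklore] -/
theorem isOpen_level' (𝔫 : Ideal (𝓞 K)) :
    IsOpen ((ResGLnCohomology.level n K 𝔫 : Subgroup (BigHeckeGLn.FiniteAdelicGL n K)) :
      Set (BigHeckeGLn.FiniteAdelicGL n K)) := by
  by_cases h : 𝔫 = 0
  · subst h
    have he : (ResGLnCohomology.level n K (0 : Ideal (𝓞 K)) : Subgroup (BigHeckeGLn.FiniteAdelicGL n K)) =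
        ResGLnCohomology.level n K (⊤ : Ideal (𝓞 K)) := by
      change (principalCongruenceLevel n K 0).comap (GLn.ofFinite n K) =
        (principalCongruenceLevel n K ⊤).comap (GLn.ofFinite n K)
      rw [principalCongruenceLevel_zero, principalCongruenceLevel_top]
    rw [he]
    exact isOpen_finitePrincipalCongruenceLevel n K (top_ne_bot : (⊤ : Ideal (𝓞 K)) ≠ ⊥)
  · exact isOpen_finitePrincipalCongruenceLevel n K h

/-! ### From coset-wise data on `G_∞ × G(𝔸_f)` to functions on `GL_n(𝔸_K)` -/

/-- **Continuity from continuity in `g_∞` per coset**: `x ↦ F(x_∞, x_f L)` is continuous when `L` is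
open and `F(·, q)` is continuous for each coset `q`. [folklore] -/
theorem continuous_of_coset' (hcpt : isCompact_glFiniteIntegralLevel n K) {Y : Type*} [TopologicalSpace Y]
    {L : Subgroup (BigHeckeGLn.FiniteAdelicGL n K)} (hL : IsOpen (L : Set (BigHeckeGLn.FiniteAdelicGL n K)))
    (F : (AutomorphyDatum.gl n K hcpt).arch.carrier → BigHeckeGLn.FiniteAdelicGL n K ⧸ L → Y)
    (hF : ∀ q, Continuous fun g => F g q) :
    Continuous fun x : (AdelicGroupData.gl n K).Adelic =>
      F ⟨GLn.toMixed n K x, Subgroup.mem_top _⟩ (QuotientGroup.mk (GLn.sndHom n K x)) := by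
  haveI : DiscreteTopology (BigHeckeGLn.FiniteAdelicGL n K ⧸ L) := QuotientGroup.discreteTopology hL
  have hF' : Continuous fun p : (AutomorphyDatum.gl n K hcpt).arch.carrier × (BigHeckeGLn.FiniteAdelicGL n K ⧸ L) =>
      F p.1 p.2 := continuous_prod_of_discrete_right.2 hF
  have harch : Continuous fun x : (AdelicGroupData.gl n K).Adelic =>
      (⟨GLn.toMixed n K x, Subgroup.mem_top _⟩ : (AutomorphyDatum.gl n K hcpt).arch.carrier) :=
    continuous_induced_rng.2 (GLn.continuous_toMixed n K)
  exact hF'.comp (harch.prodMk ((QuotientGroup.continuous_mk (N := L)).comp GLn.continuous_sndHom))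

/-- **Coset-wise polynomial bounds in `H_∞` are locally uniform in the finite variable** (with
coset-dependent constants AND exponents, and an extra factor polynomial in the adelic height, as the
twist `|det|^s` contributes): for every compact `C ⊆ GL_n(𝔸_K^∞)` one bound `A (1 ⊔ H_∞)^{r'}` holds
whenever `x_f ∈ C` — finitely many cosets meet `C`, and the finite part of the height is bounded on `C`.
[cite: BorelJacquetCorvallis1979, §1.2] -/
theorem stub_endScalar_archGrowth_of_coset_bound {n : ℕ} {K : Type} [Field K] [NumberField K] [NeZero n]
    {L : Subgroup (BigHeckeGLn.FiniteAdelicGL n K)}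
    (hL : IsOpen (L : Set (BigHeckeGLn.FiniteAdelicGL n K))) {Φ : (AdelicGroupData.gl n K).Adelic → ℂ}
    (a : BigHeckeGLn.FiniteAdelicGL n K ⧸ L → ℝ) (r : BigHeckeGLn.FiniteAdelicGL n K ⧸ L → ℕ) (k : ℕ)
    (hΦ : ∀ x : (AdelicGroupData.gl n K).Adelic,
      ‖Φ x‖ ≤ a (QuotientGroup.mk (GLn.sndHom n K x)) *
        (1 ⊔ (GLn.archHeight n K x : ℝ)) ^ (r (QuotientGroup.mk (GLn.sndHom n K x))) *
          (1 ⊔ adelicHeightGL n K x) ^ k)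
    (C : Set (GL (Fin n) (FiniteAdeleRing (𝓞 K) K))) (hC : IsCompact C) :
    ∃ (A : ℝ) (r' : ℕ), ∀ x : (AdelicGroupData.gl n K).Adelic, GLn.sndHom n K x ∈ C →
      ‖Φ x‖ ≤ A * (1 ⊔ (GLn.archHeight n K x : ℝ)) ^ r' := by
  haveI : DiscreteTopology (BigHeckeGLn.FiniteAdelicGL n K ⧸ L) := QuotientGroup.discreteTopology hL
  have hfin : ((QuotientGroup.mk : _ → BigHeckeGLn.FiniteAdelicGL n K ⧸ L) '' C).Finite :=
    (hC.image (QuotientGroup.continuous_mk (N := L))).finite_of_discrete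
  obtain ⟨A₀, hA₀⟩ := (hfin.image a).bddAbove
  obtain ⟨R₀, hR₀⟩ := (hfin.image r).bddAbove
  -- the finite part of the height, as a function of the finite component, is bounded on `C`
  set P : GL (Fin n) (FiniteAdeleRing (𝓞 K) K) → ℝ := fun h =>
    ∏ᶠ v, (GLn.localHeight n K v (GLn.ofFinite n K h) : ℝ) with hP_def
  have hPc : Continuous P :=
    (GLn.continuous_finprod_localHeight (n := n) (K := K)).comp (GLn.continuous_ofFinite n K)
  have hPeq : ∀ g : (AdelicGroupData.gl n K).Adelic,
      ∏ᶠ v, (GLn.localHeight n K v g : ℝ) = P (GLn.sndHom n K g) := fun g => by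
    simp only [hP_def]
    exact finprod_congr fun v => by
      rw [GLn.localHeight_eq_of_sndHom_eq (GLn.sndHom_ofFinite (GLn.sndHom n K g)).symm v]
  have hP1 : ∀ g : (AdelicGroupData.gl n K).Adelic, 1 ≤ P (GLn.sndHom n K g) := fun g => by
    rw [← hPeq]; exact GLn.one_le_finprod_localHeight g
  obtain ⟨B, hB⟩ := hC.bddAbove_image hPc.continuousOn
  set B' := max B 1 with hB'
  have hB'1 : 1 ≤ B' := le_max_right _ _
  have hB'0 : 0 ≤ B' := zero_le_one.trans hB'1
  refine ⟨max A₀ 0 * B' ^ k, R₀ + k, fun x hx => ?_⟩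
  set H : ℝ := 1 ⊔ (GLn.archHeight n K x : ℝ) with hH
  have hH1 : 1 ≤ H := le_sup_left
  have hH0 : 0 ≤ H := zero_le_one.trans hH1
  have ha : a (QuotientGroup.mk (GLn.sndHom n K x)) ≤ max A₀ 0 :=
    (hA₀ (Set.mem_image_of_mem a (Set.mem_image_of_mem _ hx))).trans (le_max_left _ _)
  have hr : r (QuotientGroup.mk (GLn.sndHom n K x)) ≤ R₀ :=
    hR₀ (Set.mem_image_of_mem r (Set.mem_image_of_mem _ hx))
  have hPx : P (GLn.sndHom n K x) ≤ B' := (hB (Set.mem_image_of_mem _ hx)).trans (le_max_left _ _)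
  have hadel : 1 ⊔ adelicHeightGL n K x ≤ B' * H := by
    unfold adelicHeightGL
    rw [hPeq]
    refine sup_le ?_ ?_
    · calc (1 : ℝ) = 1 * 1 := (one_mul 1).symm
        _ ≤ B' * H := mul_le_mul hB'1 hH1 zero_le_one hB'0
    · calc (GLn.archHeight n K x : ℝ) * P (GLn.sndHom n K x) ≤ H * B' :=
            mul_le_mul le_sup_right hPx (zero_le_one.trans (hP1 x)) hH0
        _ = B' * H := mul_comm _ _
  have h0 : 0 ≤ 1 ⊔ adelicHeightGL n K x := zero_le_one.trans le_sup_left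
  calc ‖Φ x‖ ≤ a (QuotientGroup.mk (GLn.sndHom n K x)) * H ^ (r (QuotientGroup.mk (GLn.sndHom n K x))) *
        (1 ⊔ adelicHeightGL n K x) ^ k := hΦ x
    _ ≤ max A₀ 0 * H ^ R₀ * (B' * H) ^ k :=
        mul_le_mul (mul_le_mul ha (pow_le_pow_right₀ hH1 hr) (pow_nonneg hH0 _) (le_max_right _ _))
          (pow_le_pow_left₀ h0 hadel k) (pow_nonneg h0 _) (mul_nonneg (le_max_right _ _) (pow_nonneg hH0 _))
    _ = max A₀ 0 * B' ^ k * H ^ (R₀ + k) := by rw [mul_pow, pow_add]; ring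

/-- **`|χ(det x)| ≤ C₀ (1 ⊔ ‖x‖)^k` for `χ = |·|_𝔸^s`.** [cite: BorelJacquetCorvallis1979, §1.2] -/
theorem exists_norm_detTwist_le' [NeZero n] {χ : HeckeCharacter K} {s : ℂ}
    (hχ : ∀ x : ideleGroup K, ((χ x : ℂˣ) : ℂ) = (ideleNorm x : ℂ) ^ s) :
    ∃ (C₀ : ℝ) (k : ℕ), 0 ≤ C₀ ∧ ∀ x : (AdelicGroupData.gl n K).Adelic,
      ‖((detTwist n χ x : ℂˣ) : ℂ)‖ ≤ C₀ * (1 ⊔ adelicHeightGL n K x) ^ k := by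
  obtain ⟨C, r, hC, h⟩ := exists_ideleNorm_det_rpow_le_height (n := n) (K := K) s.re
  refine ⟨C, r, hC.le, fun x => ?_⟩
  rw [norm_detTwist_of_cpow hχ]
  exact h x

end Summit.Langlands.Langlands.Theorems.HeckeEigenvalueField.Res

end
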